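import Summits.CriticalPhenomena.PercolationContinuityZ3.Theorems.PercNearOneGluingNoHeavyLowerTailSahiGridPatternCellForm
import Summits.CriticalPhenomena.PercolationContinuityZ3.Theorems.PercNearOneGluingNoHeavyLowerTailSahiGridPatternKernel

/-!
# `NoHeavyLowerTail` (crux stmt-CriticalPhenomena-4575), Sahi programme P1: **ASSEMBLY OF JUNTA CYLINDERS** — axis symmetries of the
# junta block, the cover of the `980` up-sets of `[3]^3`, and the transfer to any three coordinates of `[3]^d`

Support file (Sahi cell, seat `prim-sahi-p1`, generation 11; `--supports stmt-CriticalPhenomena-4575`).  One bookkeeping definition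
(`juntaPerm`), otherwise pure proofs; no `sorry`, standard axioms.  Everything here is CONDITIONAL on cylinder goodness supplied as a
hypothesis (the certificates live in `…SahiGridPatternCyl3_*`, the unconditional theorems in `…SahiGridPatternThreeCoord`):
* `cylGood_perm`: goodness of `cylSet A` in every dimension transfers along an axis permutation `τ` of the junta block
  (`p ∈ A' ↔ p ∘ τ ∈ A`), via `juntaPerm τ` (fixes the free block) and `slicePos_perm`.
* `cylGood3_of_reps` (ASSEMBLY PRINCIPLE): goodness of the cylinders over the `226` orbit representatives `repVecs` of
  `…SahiGridPatternCover` gives goodness of the cylinder over EVERY up-set of `[3]^3` (`exists_cover`, `coverData_check`).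
* `sStarD_nonneg_of_threeCoord_of_all`, `sStarD_nonneg_of_depOn3_of_all`: if every such cylinder is good, then for every `d`, every up-set
  of `[3]^d` decided by (at most) three coordinates is a good first slot — three transpositions move the coordinates to the junta block, the
  permuted set is the cylinder over one of its sections (`eq_cylSet_of_dep`), and `slicePos_perm` transports back; `d ≤ 3` is `PatternPos 3`
  (kernel, `sStarD_three_nonneg`). [this work]
-/

namespace Summit.CriticalPhenomena.PercolationContinuityZ3.Theorems.SahiGridPattern

open Finset SahiGrid3
open scoped BigOperators

variable {n : ℕ}

/-! ### Axis permutations acting on the junta block -/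

/-- The axis permutation of `[3]^{n+3}` that fixes the free block and permutes the junta block (last three axes) by `τ`. [this work] -/
def juntaPerm (τ : Equiv.Perm (Fin 3)) : Equiv.Perm (Fin (n + 3)) :=
  finSumFinEquiv.symm.trans ((Equiv.sumCongr (Equiv.refl (Fin n)) τ).trans finSumFinEquiv)

/-- `juntaPerm τ` fixes the free axes. [this work] -/
theorem juntaPerm_castAdd (τ : Equiv.Perm (Fin 3)) (a : Fin n) : juntaPerm τ (Fin.castAdd 3 a) = Fin.castAdd 3 a := by
  simp [juntaPerm]

/-- `juntaPerm τ` acts by `τ` on the junta axes. [this work] -/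
theorem juntaPerm_natAdd (τ : Equiv.Perm (Fin 3)) (b : Fin 3) : juntaPerm τ (Fin.natAdd n b) = Fin.natAdd n (τ b) := by
  simp [juntaPerm]

/-- The cell of a point precomposed with `juntaPerm τ` is the cell precomposed with `τ`. [this work] -/
theorem cellOf_comp_juntaPerm (τ : Equiv.Perm (Fin 3)) (x : Pd (n + 3)) : cellOf (x ∘ juntaPerm τ) = cellOf x ∘ τ := by
  funext b; simp [cellOf, juntaPerm_natAdd]

/-- Membership in permuted cylinders. [this work] -/
theorem mem_cylSet_perm (τ : Equiv.Perm (Fin 3)) {A A' : Finset P3} (h : ∀ p : P3, p ∈ A' ↔ p ∘ τ ∈ A) (x : Pd (n + 3)) :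
    x ∈ (cylSet A' : Finset (Pd (n + 3))) ↔ x ∘ juntaPerm τ ∈ (cylSet A : Finset (Pd (n + 3))) := by
  rw [mem_cylSet_iff, mem_cylSet_iff, cellOf_comp_juntaPerm]
  exact h _

/-- **Transfer of cylinder goodness along an axis symmetry of the junta block.** [this work] -/
theorem cylGood_perm (τ : Equiv.Perm (Fin 3)) {A A' : Finset P3}
    (hA : ∀ (n : ℕ) (B C : Finset (Pd (n + 3))), IsUpperSet (B : Set (Pd (n + 3))) → IsUpperSet (C : Set (Pd (n + 3))) →
      0 ≤ sStarD (cylSet A : Finset (Pd (n + 3))) B C)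
    (h : ∀ p : P3, p ∈ A' ↔ p ∘ τ ∈ A) :
    ∀ (n : ℕ) (B C : Finset (Pd (n + 3))), IsUpperSet (B : Set (Pd (n + 3))) → IsUpperSet (C : Set (Pd (n + 3))) →
      0 ≤ sStarD (cylSet A' : Finset (Pd (n + 3))) B C := by
  intro n B C hB hC
  rw [sStarD_eq_sum_tcD]
  refine slicePos_perm (juntaPerm τ) (A := (cylSet A : Finset (Pd (n + 3)))) (fun B' C' hB' hC' => ?_)
    (fun x => mem_cylSet_perm τ h x) B C hB hC
  rw [← sStarD_eq_sum_tcD]; exact hA n B' C' hB' hC'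

/-- **Assembly principle**: if the cylinders over the `226` orbit representatives `repVecs` are good in every dimension, then so is the
cylinder over EVERY up-set of `[3]^3`. [this work] -/
theorem cylGood3_of_reps
    (hrep : ∀ w ∈ repVecs, ∀ (n : ℕ) (B C : Finset (Pd (n + 3))), IsUpperSet (B : Set (Pd (n + 3))) → IsUpperSet (C : Set (Pd (n + 3))) →
      0 ≤ sStarD (cylSet (U w) : Finset (Pd (n + 3))) B C)
    {A : Finset P3} (hA : IsUpperSet (A : Set P3)) :
    ∀ (n : ℕ) (B C : Finset (Pd (n + 3))), IsUpperSet (B : Set (Pd (n + 3))) → IsUpperSet (C : Set (Pd (n + 3))) →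
      0 ≤ sStarD (cylSet A : Finset (Pd (n + 3))) B C := by
  obtain ⟨e, he, hUe⟩ := exists_cover hA
  have hw := hrep _ (coverData_rep_mem e he)
  rw [← hUe]
  exact cylGood_perm (permList.getD e.2.2 1) hw fun p => by rw [mem_U_iff, mem_U_iff, coverData_check e he p]

/-! ### From cylinders over the last three axes to any three coordinates of `[3]^d` -/

/-- A set decided by its cell is the cylinder over one of its sections. [this work] -/
theorem eq_cylSet_of_dep {S : Finset (Pd (n + 3))} (hdep : ∀ x y : Pd (n + 3), cellOf x = cellOf y → (x ∈ S ↔ y ∈ S)) :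
    S = (cylSet (sect S (fun _ => (0 : Fin 3))) : Finset (Pd (n + 3))) := by
  ext x
  rw [mem_cylSet_iff]
  unfold sect
  rw [mem_filter]
  simp only [mem_univ, true_and]
  exact hdep x _ (by rw [cellOf_glue])

/-- **Three-coordinate slots, every dimension, from the cylinder theorem**: if every cylinder over an up-set of `[3]^3` is a good first
slot in every dimension, then every up-set of `[3]^d` decided by three distinct coordinates `i, j, l` is a good first slot. [this work] -/
theorem sStarD_nonneg_of_threeCoord_of_all
    (hall : ∀ A : Finset P3, IsUpperSet (A : Set P3) → ∀ (n : ℕ) (B C : Finset (Pd (n + 3))),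
      IsUpperSet (B : Set (Pd (n + 3))) → IsUpperSet (C : Set (Pd (n + 3))) → 0 ≤ sStarD (cylSet A : Finset (Pd (n + 3))) B C)
    {d : ℕ} (i j l : Fin d) (hij : i ≠ j) (hil : i ≠ l) (hjl : j ≠ l) {A : Finset (Pd d)} (hA : IsUpperSet (A : Set (Pd d)))
    (hdep : ∀ x y : Pd d, x i = y i → x j = y j → x l = y l → (x ∈ A ↔ y ∈ A))
    (B C : Finset (Pd d)) (hB : IsUpperSet (B : Set (Pd d))) (hC : IsUpperSet (C : Set (Pd d))) :
    0 ≤ sStarD A B C := by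
  -- `d ≥ 3`
  obtain ⟨n, rfl⟩ : ∃ n, d = n + 3 := by
    have h3 : 3 ≤ d := by
      have hc : ({i, j, l} : Finset (Fin d)).card = 3 := by
        rw [Finset.card_insert_of_notMem (by simp [hij, hil]), Finset.card_pair hjl]
      have := Finset.card_le_univ ({i, j, l} : Finset (Fin d))
      rw [hc, Fintype.card_fin] at this
      exact this
    exact ⟨d - 3, by omega⟩
  -- an axis permutation `ρ` with `ρ i, ρ j, ρ l` = the three junta axes
  set a : Fin (n + 3) := Fin.natAdd n 0 with ha
  set b : Fin (n + 3) := Fin.natAdd n 1 with hb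
  set c : Fin (n + 3) := Fin.natAdd n 2 with hc
  have hab : a ≠ b := by rw [ha, hb]; exact fun h => by have := Fin.natAdd_inj _ |>.1 h; exact absurd this (by decide)
  have hac : a ≠ c := by rw [ha, hc]; exact fun h => by have := Fin.natAdd_inj _ |>.1 h; exact absurd this (by decide)
  have hbc : b ≠ c := by rw [hb, hc]; exact fun h => by have := Fin.natAdd_inj _ |>.1 h; exact absurd this (by decide)
  set ρ1 : Equiv.Perm (Fin (n + 3)) := Equiv.swap i a with hρ1
  have hρ1i : ρ1 i = a := by rw [hρ1, Equiv.swap_apply_left]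
  set j1 : Fin (n + 3) := ρ1 j with hj1
  have hj1a : j1 ≠ a := by rw [hj1, ← hρ1i]; exact fun h => hij (ρ1.injective h).symm
  set ρ2 : Equiv.Perm (Fin (n + 3)) := ρ1.trans (Equiv.swap j1 b) with hρ2
  have hρ2i : ρ2 i = a := by
    rw [hρ2, Equiv.trans_apply, hρ1i, Equiv.swap_apply_of_ne_of_ne hj1a.symm hab]
  have hρ2j : ρ2 j = b := by
    rw [hρ2, Equiv.trans_apply]; show Equiv.swap j1 b (ρ1 j) = b; rw [← hj1, Equiv.swap_apply_left]
  set l2 : Fin (n + 3) := ρ2 l with hl2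
  have hl2a : l2 ≠ a := by rw [hl2, ← hρ2i]; exact fun h => hil (ρ2.injective h).symm
  have hl2b : l2 ≠ b := by rw [hl2, ← hρ2j]; exact fun h => hjl (ρ2.injective h).symm
  set ρ : Equiv.Perm (Fin (n + 3)) := ρ2.trans (Equiv.swap l2 c) with hρ
  have hρi : ρ i = a := by rw [hρ, Equiv.trans_apply, hρ2i, Equiv.swap_apply_of_ne_of_ne hl2a.symm hac]
  have hρj : ρ j = b := by rw [hρ, Equiv.trans_apply, hρ2j, Equiv.swap_apply_of_ne_of_ne hl2b.symm hbc]
  have hρl : ρ l = c := by rw [hρ, Equiv.trans_apply]; show Equiv.swap l2 c (ρ2 l) = c; rw [← hl2, Equiv.swap_apply_left]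
  -- the permuted set `S = {s : s ∘ ρ ∈ A}` is decided by its cell
  set τ : Equiv.Perm (Fin (n + 3)) := ρ.symm with hτ
  set S : Finset (Pd (n + 3)) := A.map (compEquivD τ).toEmbedding with hSdef
  have memS : ∀ s : Pd (n + 3), s ∈ S ↔ s ∘ ρ ∈ A := by
    intro s; rw [hSdef, Finset.mem_map_equiv]
    show s ∘ τ.symm ∈ A ↔ _
    rw [hτ, Equiv.symm_symm]
  have hSup : IsUpperSet (S : Set (Pd (n + 3))) := by rw [hSdef]; exact isUpperSet_map_compEquivD τ hA
  have hSdep : ∀ x y : Pd (n + 3), cellOf x = cellOf y → (x ∈ S ↔ y ∈ S) := by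
    intro x y hxy
    rw [memS, memS]
    have e0 : x a = y a := by simpa [cellOf] using congrFun hxy 0
    have e1 : x b = y b := by simpa [cellOf] using congrFun hxy 1
    have e2 : x c = y c := by simpa [cellOf] using congrFun hxy 2
    refine hdep _ _ ?_ ?_ ?_
    · show x (ρ i) = y (ρ i); rw [hρi]; exact e0
    · show x (ρ j) = y (ρ j); rw [hρj]; exact e1
    · show x (ρ l) = y (ρ l); rw [hρl]; exact e2
  -- goodness of `S`, transported back along `ρ`
  have good : ∀ B' C' : Finset (Pd (n + 3)), IsUpperSet (B' : Set (Pd (n + 3))) → IsUpperSet (C' : Set (Pd (n + 3))) → 0 ≤ sStarD S B' C' := by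
    intro B' C' hB' hC'
    rw [eq_cylSet_of_dep hSdep]
    exact hall _ (isUpperSet_sect hSup _) n B' C' hB' hC'
  have h : ∀ p : Pd (n + 3), p ∈ A ↔ p ∘ τ ∈ S := by
    intro p; rw [memS]
    have e : (p ∘ τ) ∘ ρ = p := by funext x; simp [hτ]
    rw [e]
  have step : ∀ B' C' : Finset (Pd (n + 3)), IsUpperSet (B' : Set (Pd (n + 3))) → IsUpperSet (C' : Set (Pd (n + 3))) →
      0 ≤ ∑ x ∈ S, ∑ y ∈ B', ∑ w ∈ C', tcD x y w := by
    intro B' C' hB' hC'; rw [← sStarD_eq_sum_tcD]; exact good B' C' hB' hC'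
  rw [sStarD_eq_sum_tcD]
  exact slicePos_perm τ step h B C hB hC

/-- **`≤ 3`-coordinate slots, every dimension, from the cylinder theorem** (`J.card ≤ 3`, membership decided by the coordinates in `J`).
[this work] -/
theorem sStarD_nonneg_of_depOn3_of_all
    (hall : ∀ A : Finset P3, IsUpperSet (A : Set P3) → ∀ (n : ℕ) (B C : Finset (Pd (n + 3))),
      IsUpperSet (B : Set (Pd (n + 3))) → IsUpperSet (C : Set (Pd (n + 3))) → 0 ≤ sStarD (cylSet A : Finset (Pd (n + 3))) B C)
    {d : ℕ} (J : Finset (Fin d)) (hJ : J.card ≤ 3) {A : Finset (Pd d)} (hA : IsUpperSet (A : Set (Pd d)))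
    (hdep : ∀ x y : Pd d, (∀ t ∈ J, x t = y t) → (x ∈ A ↔ y ∈ A))
    (B C : Finset (Pd d)) (hB : IsUpperSet (B : Set (Pd d))) (hC : IsUpperSet (C : Set (Pd d))) :
    0 ≤ sStarD A B C := by
  by_cases hd : d ≤ 3
  · -- small dimensions: `PatternPos d` for `d ≤ 3` (kernel)
    exact patternPos_of_le hd (fun A B C hA hB hC => sStarD_three_nonneg A B C hA hB hC) A B C hA hB hC
  · -- `d ≥ 4`: enlarge `J` to exactly three distinct coordinates
    have hd4 : 4 ≤ d := by omega
    obtain ⟨i, j, l, hij, hil, hjl, hJsub⟩ : ∃ i j l : Fin d, i ≠ j ∧ i ≠ l ∧ j ≠ l ∧ ∀ t ∈ J, t = i ∨ t = j ∨ t = l := by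
      -- three distinct indices avoiding nothing in particular: extend `J` inside `Fin d` (`d ≥ 4`)
      have ex2 : ∀ s t : Fin d, ∃ u : Fin d, u ≠ s ∧ u ≠ t := fun s t => by
        by_cases h0 : (s : ℕ) = 0 ∨ (t : ℕ) = 0
        · by_cases h1 : (s : ℕ) = 1 ∨ (t : ℕ) = 1
          · refine ⟨⟨2, by omega⟩, fun h => ?_, fun h => ?_⟩
            · have := congrArg Fin.val h; simp at this; omega
            · have := congrArg Fin.val h; simp at this; omega
          · refine ⟨⟨1, by omega⟩, fun h => ?_, fun h => ?_⟩
            · have := congrArg Fin.val h; simp at this; omega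
            · have := congrArg Fin.val h; simp at this; omega
        · refine ⟨⟨0, by omega⟩, fun h => ?_, fun h => ?_⟩
          · have := congrArg Fin.val h; simp at this; omega
          · have := congrArg Fin.val h; simp at this; omega
      rcases Nat.lt_or_ge J.card 1 with h0 | h1
      · have hJ0 : J = ∅ := Finset.card_eq_zero.1 (by omega)
        obtain ⟨u, hu0, hu1⟩ := ex2 ⟨0, by omega⟩ ⟨1, by omega⟩
        refine ⟨⟨0, by omega⟩, ⟨1, by omega⟩, u, fun h => by have := congrArg Fin.val h; simp at this, hu0.symm, hu1.symm, ?_⟩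
        intro t ht; rw [hJ0] at ht; simp at ht
      rcases Nat.lt_or_ge J.card 2 with h1' | h2
      · obtain ⟨s, hJs⟩ := Finset.card_eq_one.1 (show J.card = 1 by omega)
        obtain ⟨t, hts, _⟩ := ex2 s s
        obtain ⟨u, hus, hut⟩ := ex2 s t
        refine ⟨s, t, u, hts.symm, hus.symm, hut.symm, fun x hx => ?_⟩
        rw [hJs, Finset.mem_singleton] at hx; exact Or.inl hx
      rcases Nat.lt_or_ge J.card 3 with h2' | h3
      · obtain ⟨s, t, hst, hJst⟩ := Finset.card_eq_two.1 (show J.card = 2 by omega)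
        obtain ⟨u, hus, hut⟩ := ex2 s t
        refine ⟨s, t, u, hst, hus.symm, hut.symm, fun x hx => ?_⟩
        rw [hJst, Finset.mem_insert, Finset.mem_singleton] at hx
        rcases hx with hx | hx
        · exact Or.inl hx
        · exact Or.inr (Or.inl hx)
      · obtain ⟨s, t, u, hst, hsu, htu, hJstu⟩ := Finset.card_eq_three.1 (show J.card = 3 by omega)
        refine ⟨s, t, u, hst, hsu, htu, fun x hx => ?_⟩
        rw [hJstu, Finset.mem_insert, Finset.mem_insert, Finset.mem_singleton] at hx
        exact hx
    refine sStarD_nonneg_of_threeCoord_of_all hall i j l hij hil hjl hA (fun x y hi hj hl => hdep x y fun t ht => ?_) B C hB hC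
    rcases hJsub t ht with rfl | rfl | rfl
    · exact hi
    · exact hj
    · exact hl

end Summit.CriticalPhenomena.PercolationContinuityZ3.Theorems.SahiGridPattern
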